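import Mathlib
import HarnessLib
import Literature.Probability.MarkovChains.RandomTargetLemma
import Literature.Probability.MarkovChains.TransitiveChains

/-!
# Hitting times of a transitive chain: `E_π(τ_w) = t⊙` for every `w`, and `t_hit ≤ 2 t⊙` (Corollary 10.3)

HONEST FRAMING: exact (Metropolis-corrected) sampling algorithms for lattice gauge theory; figures
of merit are autocorrelation/cost numbers at stated couplings and volumes; no continuum-physics claim.

Source: D. A. Levin, Y. Peres (with E. L. Wilmer), *Markov Chains and Mixing Times*, 2nd ed.,
AMS 2017 [LevinPeres2017], §10.2, the paragraph after the proof of Lemma 10.2 and COROLLARY 10.3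
(p. 130), with §2.6.2 (transitive chains, eq. (2.15), Prop. 2.16, p. 29).  Conventions of
`RandomTargetLemma.lean` (`IsHittingTimeSolution P h`: `h a x = E_a(τ_x)` through the first-step
system; `targetTime π h a = t⊙`) and `TransitiveChains.lean` (`IsTransitive`,
`LevinPeres2017_prop_2_16`: the uniform law is stationary).  Everything is PROVED (0 named facts).

* `IsHittingTimeSolution.comp_equiv` / `IsHittingTimeSolution.equiv_invariant` — a `P`-preserving
  bijection `φ` preserves expected hitting times: `E_{φa}(τ_{φx}) = E_a(τ_x)` (the system (10.3) is
  `φ`-invariant and has a unique solution) [cite: LevinPeres2017, §2.6.2 eq. (2.15) with §10.2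
  eq. (10.3); uniqueness: `RandomTargetLemma.lean`];
* `stationaryHitting_eq_of_isTransitive` — "for a transitive chain, `E_π(τ_w)` does not depend on
  `w`" [cite: LevinPeres2017, §10.2, remark before Cor. 10.3, p. 130];
* `stationaryHitting_eq_targetTime` — "by averaging, for any `w`, we obtain
  `E_π(τ_w) = E_π(τ_π) = t⊙`" [cite: LevinPeres2017, §10.2, p. 130, with eq. (10.5)];
* **COROLLARY 10.3** `LevinPeres2017_cor_10_3` — for an irreducible transitive Markov chain,
  **`t_hit ≤ 2 t⊙`**: every `E_a(τ_y) ≤ 2 t⊙` [cite: LevinPeres2017, §10.2 Cor. 10.3].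

Context (cell pub-lqcd): translation-invariant local updates on a periodic lattice and random walks
on groups are transitive (`TransitiveChains.lean`); for them the worst-case hitting time is within a
factor two of the stationary target time, the quantity the random target lemma makes start-free.
-/

namespace Literature.Probability.MarkovChains

open Finset Matrix

variable {X : Type*} [Fintype X] [DecidableEq X] {P : Matrix X X ℝ} {π : X → ℝ}

/-! ## Hitting times are invariant under `P`-preserving bijections -/

omit [DecidableEq X] in
/-- If `h` solves the first-step system (10.3) for `P` and `φ` is a `P`-preserving bijection
(`P(z,w) = P(φz,φw)`, eq. (2.15)), then `(a,x) ↦ h(φa, φx)` solves it too.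
[cite: LevinPeres2017, §2.6.2 eq. (2.15); §10.2 eq. (10.3)] -/
theorem IsHittingTimeSolution.comp_equiv {h : X → X → ℝ} (hh : IsHittingTimeSolution P h)
    (φ : X ≃ X) (hφ : ∀ z w, P z w = P (φ z) (φ w)) :
    IsHittingTimeSolution P (fun a x => h (φ a) (φ x)) := by
  refine ⟨fun x => hh.diag (φ x), fun a x hax => ?_⟩
  have hne : φ a ≠ φ x := fun e => hax (φ.injective e)
  have step := hh.off_diag hne
  -- re-index the first-step sum with `y = φ v`
  have hsum : ∑ y, P (φ a) y * h y (φ x) = ∑ v, P a v * h (φ v) (φ x) := by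
    rw [← Equiv.sum_comp φ (fun y => P (φ a) y * h y (φ x))]
    exact sum_congr rfl fun v _ => by rw [← hφ a v]
  simpa only [hsum] using step

/-- **`E_{φa}(τ_{φx}) = E_a(τ_x)`** for a `P`-preserving bijection `φ` of an irreducible chain (the
solution of (10.3) is unique). [cite: LevinPeres2017, §2.6.2 eq. (2.15) ("the chain looks the same
from any point"); §10.2 eq. (10.3)] -/
theorem IsHittingTimeSolution.equiv_invariant (hP : IsRowStochastic P) (hirr : IsIrreducible P)
    {h : X → X → ℝ} (hh : IsHittingTimeSolution P h) (φ : X ≃ X)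
    (hφ : ∀ z w, P z w = P (φ z) (φ w)) (a x : X) : h (φ a) (φ x) = h a x := by
  have := IsHittingTimeSolution.unique hP hirr (hh.comp_equiv φ hφ) hh
  exact congrFun (congrFun this a) x

/-! ## For a transitive chain `E_π(τ_w)` does not depend on `w` and equals `t⊙` -/

/-- "Note that for a transitive chain, `E_π(τ_w)` does not depend on `w`": with the uniform
stationary law, `Σ_x π(x) E_x(τ_w) = Σ_x π(x) E_x(τ_{w'})`. [cite: LevinPeres2017, §10.2, p. 130
(sentence before Cor. 10.3); §2.6.2 Prop. 2.16] -/
theorem stationaryHitting_eq_of_isTransitive (hT : IsTransitive P) (hP : IsRowStochastic P)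
    (hirr : IsIrreducible P) (hπu : ∀ x, π x = (Fintype.card X : ℝ)⁻¹) {h : X → X → ℝ}
    (hh : IsHittingTimeSolution P h) (w w' : X) :
    ∑ x, π x * h x w = ∑ x, π x * h x w' := by
  obtain ⟨φ, hφw, hφ⟩ := hT w w'
  simp_rw [hπu]
  rw [← mul_sum, ← mul_sum]
  congr 1
  calc ∑ x, h x w = ∑ x, h (φ x) (φ w) :=
        sum_congr rfl fun x _ => (hh.equiv_invariant hP hirr φ hφ x w).symm
    _ = ∑ x, h (φ x) w' := by rw [hφw]
    _ = ∑ y, h y w' := Equiv.sum_comp φ (fun y => h y w')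

/-- "By averaging, for any `w`, we obtain `E_π(τ_w) = E_π(τ_π) = t⊙`" (transitive, irreducible chain,
uniform `π`). [cite: LevinPeres2017, §10.2, p. 130, with Lemma 10.1 / eq. (10.5)] -/
theorem stationaryHitting_eq_targetTime (hT : IsTransitive P) (hP : IsRowStochastic P)
    (hirr : IsIrreducible P) (hπu : ∀ x, π x = (Fintype.card X : ℝ)⁻¹) {h : X → X → ℝ}
    (hh : IsHittingTimeSolution P h) (w a : X) :
    ∑ x, π x * h x w = targetTime π h a := by
  have hπ : IsStationary π P := LevinPeres2017_prop_2_16 hT hP hπu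
  have hn : (Fintype.card X : ℝ) ≠ 0 := by
    have : 0 < Fintype.card X := Fintype.card_pos_iff.mpr ⟨w⟩
    exact_mod_cast this.ne'
  have hπ1 : ∑ x, π x = 1 := by
    simp_rw [hπu]
    rw [sum_const, card_univ, nsmul_eq_mul, mul_inv_cancel₀ hn]
  -- average the `w`-independent quantity `E_π(τ_w)` over `w ∼ π`: this is (10.5)
  have havg : ∑ v, π v * ∑ x, π x * h x v = ∑ x, π x * h x w := by
    rw [sum_congr rfl fun v _ => by rw [stationaryHitting_eq_of_isTransitive hT hP hirr hπu hh v w],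
      ← sum_mul, hπ1, one_mul]
  rw [← havg, LevinPeres2017_eq_10_5 hP hirr hπ hπ1 hh a, sum_comm]
  refine sum_congr rfl fun v _ => ?_
  rw [mul_sum]
  exact sum_congr rfl fun x _ => by ring

/-! ## Corollary 10.3 -/

/-- **COROLLARY 10.3.**  For an irreducible transitive Markov chain, **`t_hit ≤ 2 t⊙`**: every
expected hitting time satisfies `E_a(τ_y) ≤ 2 t⊙` (`t_hit = max_{a,y} E_a(τ_y)`, eq. (10.6); `t⊙` the
target time of the uniform stationary law, start-free by Lemma 10.1).  Proof as printed: Lemma 10.2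
with `E_π(τ_w) = t⊙` for every `w`. [cite: LevinPeres2017, §10.2 Cor. 10.3] -/
theorem LevinPeres2017_cor_10_3 (hT : IsTransitive P) (hP : IsRowStochastic P)
    (hirr : IsIrreducible P) (hπu : ∀ x, π x = (Fintype.card X : ℝ)⁻¹) {h : X → X → ℝ}
    (hh : IsHittingTimeSolution P h) (a₀ a y : X) : h a y ≤ 2 * targetTime π h a₀ := by
  have hπ : IsStationary π P := LevinPeres2017_prop_2_16 hT hP hπu
  have hn : (0 : ℝ) < Fintype.card X := by exact_mod_cast Fintype.card_pos_iff.mpr ⟨a⟩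
  have hπ1 : ∑ x, π x = 1 := by
    simp_rw [hπu]
    rw [sum_const, card_univ, nsmul_eq_mul, mul_inv_cancel₀ hn.ne']
  have hπ0 : ∀ x, 0 ≤ π x := fun x => by rw [hπu]; positivity
  exact LevinPeres2017_lemma_10_2 hP hirr hπ hπ1 hπ0 hh
    (M := targetTime π h a₀) (fun w => (stationaryHitting_eq_targetTime hT hP hirr hπu hh w a₀).le) a y

end Literature.Probability.MarkovChains
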